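import Summits.ResolutionOfSingularities.ResolutionOfSingularities.Theorems.DeltaCutStellarStrategy
import Literature.AlgebraicGeometry.Resolution.StrictNormalCrossingsHasSNC
import Literature.AlgebraicGeometry.Resolution.KollarMaxContactPersistence

/-!
# DeltaCutStellarWOR — ADDENDUM tree file 6 of the decomp-res lens-6 g32 node «StellarCut»: `worNC_holds` — THE BARRIER'S
# COMPLEMENT `WORNC n` HOLDS FOR EVERY `n ≥ 1`, HYPOTHESIS-FREE (g33 window (1)(c), the +1 item)

`WORNC n` (landed VERBATIM in `Theorems/DeltaCutStellarCells.lean`): every base `n`-datum `(Y → Spec k, M)` (char `p`,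
`IsBase`: separated, locally of finite type, quasi-compact, `Y` regular of dimension `≤ 4`; `IsDatum n M`) whose stage
`(Y, M.ideal)` is an IDEAL-SHAPE LABELLED N.C. STAGE (`IsNCStage n`: an `NCFrame (H; D₁ … D_r; a₁ … a_r)` with `H ∪ ⋃ Dᵢ` a
strict normal crossings divisor whose components are exactly `H` and the `Dᵢ`, and `M.ideal = 𝓘(H)ⁿ + Π 𝓘(Dᵢ)^{aᵢ}`)
admits a tree `WeakResolution`.  PROVED HERE for all `n ≥ 1` (all `p`, all dimensions — neither the characteristic nor
`dim ≤ 4` nor `SuppLE` is used), by the bridge to the list-level face strategy of `DeltaCutStellarStrategy`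
(`exists_weakResolution_ncShape`):

* `isGenericPoint_mem_maxPoints` — in a family of closed sets with no containments, the generic point of a member is a
  maximal point of the union (pure topology; quasi-sober `T₀` spaces);
* (Literature `HasSNC.of_subset`, `KollarMaxContactPersistence` — `HasSNC` only depends on the SET of listed divisors,
  monotonically; cited, not restated);
* `NCFrame.IsSNC.hasSNC_of_forall_mem` — THE BRIDGE: for an s.n.c. frame on a regular Noetherian `Y`, any list of
  vanishing ideals of members of the frame (e.g. `𝓘(H) :: 𝓘(H) :: [𝓘(D₁), …, 𝓘(D_r)]`) has simple normal crossings in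
  the sense of BGMW Def. 3.1.1 (`HasSNC`), via Stacks 0BIA (2) ⇒ (1) (`IsStrictNormalCrossingsDivisor.exists_hasSNC`)
  and the identification of the frame's members with irreducible components of `H ∪ ⋃ Dᵢ`;
* `NCFrame.monomialIdeal_expList` — `Π 𝓘(Dᵢ)^{aᵢ}` is the monomial ideal of the exponent list
  `NCFrame.expList = [(𝓘(Dᵢ), aᵢ)]ᵢ`; `NCFrame.IsSNC.listData` — the three list-level hypotheses of
  `exists_weakResolution_ncShape` for `E := (𝓘(H), 0) :: expList` from `IsSNC ∧ IdealShape n`;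
* ★ `worNC_holds (n) (hn : 1 ≤ n) : WORNC n` (`SuppLE` is discarded — it is implied by `IdealShape` for `n ≥ 1`,
  `suppLE_of_idealShape` of `DeltaCutStellarSupport`; `IsSNC` and `IdealShape` are load-bearing).

0 sorry; axioms standard.  Imports: the pinned T5 `DeltaCutStellarStrategy` (→ T4 → landed T2) + Literature
`StrictNormalCrossingsHasSNC`, `KollarMaxContactPersistence` (for `HasSNC.of_subset`).
-/

noncomputable section

open CategoryTheory CategoryTheory.Limits AlgebraicGeometry TopologicalSpace Topology IsLocalRing
open Literature.AlgebraicGeometry.Resolution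

namespace Summit.ResolutionOfSingularities.ResolutionOfSingularities.Theorems.DeltaCutClasses

open Summit.ResolutionOfSingularities.ResolutionOfSingularities.Theorems
open WeakOrderReduction ForcedTowerClasses
open _root_.AlgebraicGeometry.Scheme.IdealSheafData (vanishingIdeal)

/-! ## Generic points of the members of a containment-free family are maximal points of the union -/

section GenericPoints

variable {α : Type*} [TopologicalSpace α] [T0Space α] {ι : Type*}

/-- In a family of closed sets `W i` with `W i ⊆ W j → W j ⊆ W i`, the generic point of `W i` is a maximal point of
`⋃ j, W j` (a specialisation `η' ⤳ ξ` inside the union forces `W i ⊆ W j ∋ η'`, hence `η' ∈ W i = cl {ξ}`). -/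
theorem isGenericPoint_mem_maxPoints {W : ι → Set α} (hcl : ∀ i, IsClosed (W i))
    (hnc : ∀ i j, W i ⊆ W j → W j ⊆ W i) {i : ι} {ξ : α} (hξ : IsGenericPoint ξ (W i)) :
    ξ ∈ maxPoints (⋃ j, W j) := by
  refine mem_maxPoints_iff.mpr ⟨Set.mem_iUnion.mpr ⟨i, hξ.mem⟩, fun η' hη' hsp => ?_⟩
  obtain ⟨j, hj⟩ := Set.mem_iUnion.mp hη'
  -- `ξ ∈ cl {η'} ⊆ W j`, so `W i = cl {ξ} ⊆ W j`
  have hξj : ξ ∈ W j := (hcl j).closure_subset_iff.mpr (Set.singleton_subset_iff.mpr hj)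
    (specializes_iff_mem_closure.mp hsp)
  have hij : W i ⊆ W j := by
    rw [← hξ.def]
    exact (hcl j).closure_subset_iff.mpr (Set.singleton_subset_iff.mpr hξj)
  have hη'i : η' ∈ W i := hnc i j hij hj
  exact (hsp.antisymm (hξ.specializes hη'i)).eq

end GenericPoints

/-! ## The bridge: an s.n.c. frame gives Literature list data -/

section Bridge

variable {N : Stage}

namespace NCFrame

/-- The members of a frame as a family indexed by `Option (Fin r)`: `none ↦ H`, `some i ↦ Dᵢ`. -/
def member (F : NCFrame N) : Option (Fin F.r) → Set N.Y
  | none => (F.H : Set N.Y)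
  | some i => (F.D i : Set N.Y)

/-- `member_none`: StellarCut T6 (lens-6 g32) helper, VERBATIM from the lens file; docstring added by the writer (lint.docstring) [folklore] -/
theorem member_none (F : NCFrame N) : F.member none = (F.H : Set N.Y) := rfl

/-- `member_some`: StellarCut T6 (lens-6 g32) helper, VERBATIM from the lens file; docstring added by the writer (lint.docstring) [folklore] -/
theorem member_some (F : NCFrame N) (i : Fin F.r) : F.member (some i) = (F.D i : Set N.Y) := rfl

/-- `H ∪ ⋃ Dᵢ = ⋃_o member o`. -/
theorem iUnion_member (F : NCFrame N) : (⋃ o, F.member o) = (F.H : Set N.Y) ∪ ⋃ i, (F.D i : Set N.Y) := by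
  rw [Set.iUnion_option]
  rfl

/-- `isClosed_member`: StellarCut T6 (lens-6 g32) helper, VERBATIM from the lens file; docstring added by the writer (lint.docstring) [folklore] -/
theorem isClosed_member (F : NCFrame N) (o : Option (Fin F.r)) : IsClosed (F.member o) := by
  cases o with
  | none => exact F.H.isClosed
  | some i => exact (F.D i).isClosed

/-- In an s.n.c. frame the members are irreducible. -/
theorem IsSNC.isIrreducible_member {F : NCFrame N} (hS : F.IsSNC) (o : Option (Fin F.r)) :
    IsIrreducible (F.member o) := by
  cases o with
  | none => exact hS.2.1
  | some i => exact hS.2.2.1 i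

/-- In an s.n.c. frame the members are containment-free. -/
theorem IsSNC.member_subset {F : NCFrame N} (hS : F.IsSNC) (o o' : Option (Fin F.r))
    (h : F.member o ⊆ F.member o') : F.member o' ⊆ F.member o := by
  obtain ⟨-, -, -, hHD, hDH, hDD⟩ := hS
  cases o with
  | none =>
    cases o' with
    | none => exact le_rfl
    | some j => exact absurd h (hHD j)
  | some i =>
    cases o' with
    | none => exact absurd h (hDH i)
    | some j =>
      by_cases hij : i = j
      · subst hij; exact le_rfl
      · exact absurd h (hDD i j hij)

/-- The vanishing ideal of a member. -/
theorem vanishingIdeal_member {F : NCFrame N} (o : Option (Fin F.r)) :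
    vanishingIdeal ⟨F.member o, F.isClosed_member o⟩ =
      Option.elim o (vanishingIdeal F.H) fun i => vanishingIdeal (F.D i) := by
  cases o with
  | none => rfl
  | some i => rfl

/-- **The bridge.** For an s.n.c. frame on a regular Noetherian scheme, every list of vanishing ideals of members of
the frame has simple normal crossings in Literature's sense (`HasSNC`): the members are irreducible components of the
strict normal crossings divisor `H ∪ ⋃ Dᵢ` (their generic points are maximal points, `isGenericPoint_mem_maxPoints`),
whose component ideals have `HasSNC` by `IsStrictNormalCrossingsDivisor.exists_hasSNC` (Stacks 0BIA). -/
theorem IsSNC.hasSNC_of_forall_mem [IsNoetherian N.Y] (hY : Scheme.IsRegular N.Y) {F : NCFrame N} (hS : F.IsSNC)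
    {L : List N.Y.IdealSheafData}
    (hL : ∀ K ∈ L, ∃ o : Option (Fin F.r), K = vanishingIdeal ⟨F.member o, F.isClosed_member o⟩) : HasSNC L := by
  obtain ⟨E₀, hE₀, -, hall, -⟩ := hS.1.exists_hasSNC hY
  refine HasSNC.of_subset (fun K hK => ?_) hE₀
  obtain ⟨o, rfl⟩ := hL K hK
  -- the generic point of the member is a maximal point of `H ∪ ⋃ Dᵢ`
  obtain ⟨ξ, hξ⟩ := QuasiSober.sober (hS.isIrreducible_member o) (F.isClosed_member o)
  have hmax : ξ ∈ maxPoints ((F.H : Set N.Y) ∪ ⋃ i, (F.D i : Set N.Y)) := by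
    rw [← F.iUnion_member]
    exact isGenericPoint_mem_maxPoints F.isClosed_member hS.member_subset hξ
  have hcl : (⟨closure {ξ}, isClosed_closure⟩ : Closeds N.Y) = ⟨F.member o, F.isClosed_member o⟩ :=
    Closeds.ext hξ.def
  have := hall ξ hmax
  rwa [hcl] at this

/-- The frame's exponent list `[(𝓘(D₁), a₁), …, (𝓘(D_r), a_r)]`. -/
def expList (F : NCFrame N) : List (N.Y.IdealSheafData × ℕ) :=
  List.ofFn fun i => (vanishingIdeal (F.D i), F.a i)

/-- Its monomial ideal is the frame's boundary ideal `Π 𝓘(Dᵢ)^{aᵢ}`. -/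
theorem monomialIdeal_expList (F : NCFrame N) : monomialIdeal F.expList = F.boundary := by
  rw [monomialIdeal, expList, List.map_ofFn, List.prod_ofFn]
  rfl

/-- Its divisors are the `𝓘(Dᵢ)`. -/
theorem mem_boundaryOf_expList_iff (F : NCFrame N) {K : N.Y.IdealSheafData} :
    K ∈ boundaryOf F.expList ↔ ∃ i, K = vanishingIdeal (F.D i) := by
  simp only [expList, List.map_ofFn, List.mem_ofFn, Function.comp_def]
  exact ⟨fun ⟨i, hi⟩ => ⟨i, hi.symm⟩, fun ⟨i, hi⟩ => ⟨i, hi.symm⟩⟩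

/-- **The list data of an ideal-shape s.n.c. frame**: with `E := (𝓘(H), 0) :: [(𝓘(Dᵢ), aᵢ)]ᵢ` one has
`𝓘(H) ∈ boundaryOf E`, `HasSNC (𝓘(H) :: boundaryOf E)` and `N.I = 𝓘(H)ⁿ + monomialIdeal E`. -/
theorem IsSNC.listData [IsNoetherian N.Y] (hY : Scheme.IsRegular N.Y) {F : NCFrame N} (hS : F.IsSNC) {n : ℕ}
    (hF : F.IdealShape n) :
    vanishingIdeal F.H ∈ boundaryOf ((vanishingIdeal F.H, 0) :: F.expList) ∧
      HasSNC (vanishingIdeal F.H :: boundaryOf ((vanishingIdeal F.H, 0) :: F.expList)) ∧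
      N.I = vanishingIdeal F.H ^ n + monomialIdeal ((vanishingIdeal F.H, 0) :: F.expList) := by
  refine ⟨List.mem_cons_self .., hS.hasSNC_of_forall_mem hY fun K hK => ?_, ?_⟩
  · have hK : K = vanishingIdeal F.H ∨ K ∈ boundaryOf F.expList := by
      simpa only [List.map_cons, List.mem_cons, or_self_left] using hK
    rcases hK with rfl | hK
    · exact ⟨none, rfl⟩
    · obtain ⟨i, rfl⟩ := F.mem_boundaryOf_expList_iff.mp hK
      exact ⟨some i, rfl⟩
  · rw [monomialIdeal_cons_zero, monomialIdeal_expList]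
    exact hF

end NCFrame

end Bridge

/-! ## ★ `WORNC n` holds -/

section WORNC

/-- ★ **THE BARRIER'S COMPLEMENT HOLDS: `WORNC n` for every `n ≥ 1`, hypothesis-free.**  Every base `n`-datum whose
stage is an ideal-shape labelled n.c. stage (`IsNCStage n ⟨Y, M.ideal⟩`: `M.ideal = 𝓘(H)ⁿ + Π 𝓘(Dᵢ)^{aᵢ}` on an s.n.c.
frame) admits a weak resolution — by the TERMINATING FACE STRATEGY (Kollár's (3.111) Step 3 measure relativised to
the faces through `H`, `exists_weakResolution_ncShape`), whose rounds stay in the ideal shape (`ncShape_round`: square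
contact is permanent contact).  The characteristic, `dim ≤ 4` and `SuppLE` are not used. -/
theorem worNC_holds (n : ℕ) (hn : 1 ≤ n) : WORNC n := by
  intro p _ k _ _ Y g hB M hM hNC
  haveI := hB.locallyOfFiniteType
  haveI := hB.quasiCompact
  haveI : IsLocallyNoetherian Y := LocallyOfFiniteType.isLocallyNoetherian g
  haveI : CompactSpace Y := QuasiCompact.compactSpace_of_compactSpace g
  haveI : IsNoetherian Y := {}
  obtain ⟨F, hS, hF, -⟩ := hNC
  obtain ⟨hH, hEs, hI⟩ := hS.listData hB.isRegular hF
  exact exists_weakResolution_ncShape hEs hH hn M hI hM.1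

end WORNC

end Summit.ResolutionOfSingularities.ResolutionOfSingularities.Theorems.DeltaCutClasses
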